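import Summits.HubbardSuperconductivity.HubbardSuperconductivity.Theorems.ThermalWedgeTwTipContinuationWeakCouplingDarknessCount
import Summits.HubbardSuperconductivity.HubbardSuperconductivity.Theorems.ThermalWedgeTwTipContinuationWeakCouplingDarknessCoherence
import Summits.HubbardSuperconductivity.HubbardSuperconductivity.Theorems.ThermalWedgeTwTipContinuationWeakCouplingDarknessKinetic
import Summits.HubbardSuperconductivity.HubbardSuperconductivity.Theorems.TwTipContinuation.Negative.SeedContinuity
import Mathlib.Algebra.Order.Chebyshev

/-!
# `TwTipContinuation` (stmt-HubbardSuperconductivity-1700) — the weak-coupling darkness bound: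
# every ground state of the weakly repulsive Hubbard torus has d-wave pair intensity `O(U^{1/3}) L⁴`

Route `ThermalWedge`, crux rank 6 ("the bet"). The crux is LITERALLY the `U`-uniform summit
window (`twTipContinuation_iff_everyGSOrder_window`, landed in `…AnchorDischarge.lean`): eventual
EVERY-ground-state d-wave order `c(U) L⁴ ≤ re⟨ψ, P_L ψ⟩` of the pure torus `hubbardTorus 2 L 1 U`
for ALL `U ∈ (0, U₁]` at one doping `δ ∈ [1/10, 2/5]`. This file PROVES the quantitative
constraint every such window must obey, and thereby REFUTES its `U`-uniform strengthening:

* `pairIntensity_groundState_le` — for `L ≥ 3`, `u > 0`, `0 ≤ U ≤ u⁶`, every sector `(2n, S^z=0)`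
  and EVERY normalised ground state `ψ` of `hubbardTorus 2 L 1 U`:
  `re⟨ψ, (pairField d L)ᴴ (pairField d L) ψ⟩ ≤ 256 u² L⁴ + 288 L²`;
  `pairIntensity_groundState_le_rpow` — the same as `256 U^{1/3} L⁴ + 288 L²` (`U > 0`);
* `orderConstant_le` — an eventual every-GS order constant at coupling `U ≤ u⁶` is `≤ 256 u²`:
  the d-wave order parameter density of ANY ground state is `O(U^{1/3})` as `U → 0⁺`, uniformly in
  the filling;
* `not_uniformOrderWindow` — **the `U`-uniform every-GS order window is FALSE** at every doping
  `δ ≥ -1`: there are no `c, U₁ > 0` with order constant `c` for all `U ∈ (0, U₁]`;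
  `existsGSOrderConstant_le`, `not_uniformRungsWindow` — the same for ∃-ground-state order and for
  `U`-uniform RUNGS of the seeded family down to seed `0⁺` (closure of ground states as `g ↓ 0`,
  `exists_groundState_order_of_uniformSeeds`): no rung ladder with `U`-uniform constants reaches `g = 0`;
* `twTipContinuation_orderConstants_vanish` — hence the crux's own witness: if `TwTipContinuation`
  holds, its order constants satisfy `c(U) ≤ 256 U^{1/3} → 0`; together with the O(1)-seeded anchor
  (`seededOrder_of_weakCoupling`: order constant `μ(δ,c) > 0` INDEPENDENT of `U` at seed `c = 1/20`)
  this quantifies the transport the Tip demands: from an O(1) order constant at seed `1/20` to an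
  `O(U^{1/3})` one at seed `0` — no continuity/compactness argument in the seed can supply it.

## Proof (pieces 1–3 in the sibling files `…Count`, `…Coherence`, `…Slater`, `…Kinetic`)

Let `ρ_k = ⟨n_{k↑}⟩_ψ`, `q_k = ρ_k(1-ρ_k) ∈ [0, 1/4]`, `ξ_k = ε_L(k) - μ` at the Fermi level `μ` of
piece 3b. (i) Smearing budget: `Σ_k |ξ_k| q_k ≤ U L²` (`smearing_le_of_groundState`).
(ii) Coherence: `re⟨P_L⟩ ≤ 32L² + 32(Σ_k F_k)²`, `0 ≤ F_k`, `F_k⁴ ≤ q_k` (`pairIntensity_le_coherence`).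
(iii) Thin shell `S = {|ξ_k| < u²}`: `#S ≤ L(L u/√2 + 2)` (`torusShell_count_uniform`), and `F_k ≤ 1`,
so `Σ_S F ≤ uL² + 2L`. (iv) Off the shell, Cauchy–Schwarz twice (power mean):
`(Σ_{Sᶜ} F)⁴ ≤ |Sᶜ|³ Σ_{Sᶜ} F⁴ ≤ L⁶ Σ_{Sᶜ} q_k ≤ L⁶ u⁻² Σ |ξ_k| q_k ≤ L⁶ u⁻² U L² ≤ (uL²)⁴`, so
`Σ_{Sᶜ} F ≤ uL²`. (v) `Σ F ≤ 2uL² + 2L`, `(Σ F)² ≤ 8u²L⁴ + 8L²`, `re⟨P_L⟩ ≤ 256u²L⁴ + 288L²`.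
Physically: macroscopic pair coherence needs a Fermi surface smeared over a positive fraction of
the zone, which costs kinetic energy `∝ L²` that only the interaction budget `U L²` can pay.
Elementary and rigorous; consistent with BCS/Kohn–Luttinger asymptotics (order parameter
`∼ e^{-1/λ(U)}`, far below `U^{1/3}`). No new definitions, no named facts. [folklore]
-/

noncomputable section

namespace Summit.HubbardSuperconductivity.TwTipContinuation.WeakCouplingDarkness

open Matrix Filter Finset
open Literature.MathematicalPhysics.QuantumLattice Literature.Probability.LatticeModels
open Summit.HubbardSuperconductivity.HubbardSuperconductivity.Theses.ThermalWedge
open Summit.HubbardSuperconductivity.TwTipContinuation.IsogapTransport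
open Summit.HubbardSuperconductivity.TwTipContinuation.Negative
open Summit.HubbardSuperconductivity.TwTipContinuation.AnchorDischarge
open scoped ComplexOrder

/-! ### Real-analysis helpers -/

/-- Power mean: `(Σ_{i∈s} f i)⁴ ≤ |s|³ Σ_{i∈s} (f i)⁴` for real `f` (Cauchy–Schwarz twice). [folklore] -/
theorem pow_four_sum_le {ι : Type*} (s : Finset ι) (f : ι → ℝ) :
    (∑ i ∈ s, f i) ^ 4 ≤ (s.card : ℝ) ^ 3 * ∑ i ∈ s, f i ^ 4 := by
  have h1 : (∑ i ∈ s, f i) ^ 2 ≤ s.card * ∑ i ∈ s, f i ^ 2 := sq_sum_le_card_mul_sum_sq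
  have h2 : (∑ i ∈ s, f i ^ 2) ^ 2 ≤ s.card * ∑ i ∈ s, (f i ^ 2) ^ 2 := sq_sum_le_card_mul_sum_sq
  have h4 : ∑ i ∈ s, (f i ^ 2) ^ 2 = ∑ i ∈ s, f i ^ 4 :=
    Finset.sum_congr rfl fun i _ => by ring
  rw [h4] at h2
  have h0 : 0 ≤ (∑ i ∈ s, f i) ^ 2 := sq_nonneg _
  have hs0 : 0 ≤ ∑ i ∈ s, f i ^ 4 := Finset.sum_nonneg fun i hi => by positivity
  calc (∑ i ∈ s, f i) ^ 4 = ((∑ i ∈ s, f i) ^ 2) ^ 2 := by ring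
    _ ≤ (s.card * ∑ i ∈ s, f i ^ 2) ^ 2 := pow_le_pow_left₀ h0 h1 2
    _ = (s.card : ℝ) ^ 2 * (∑ i ∈ s, f i ^ 2) ^ 2 := by ring
    _ ≤ (s.card : ℝ) ^ 2 * (s.card * ∑ i ∈ s, f i ^ 4) := mul_le_mul_of_nonneg_left h2 (by positivity)
    _ = (s.card : ℝ) ^ 3 * ∑ i ∈ s, f i ^ 4 := by ring

/-- Fourth roots are monotone: `A⁴ ≤ B⁴`, `A, B ≥ 0` give `A ≤ B`. [folklore] -/
theorem le_of_pow_four_le {A B : ℝ} (hA : 0 ≤ A) (hB : 0 ≤ B) (h : A ^ 4 ≤ B ^ 4) : A ≤ B :=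
  (pow_le_pow_iff_left₀ hA hB (by norm_num : (4 : ℕ) ≠ 0)).1 h

/-- `F⁴ ≤ ρ(1-ρ)` and `F ≥ 0` give `F ≤ 1` (`ρ(1-ρ) ≤ 1/4`). [folklore] -/
theorem le_one_of_pow_four_le_smear {F ρ : ℝ} (hF : 0 ≤ F) (h : F ^ 4 ≤ ρ * (1 - ρ)) : F ≤ 1 := by
  have hq : ρ * (1 - ρ) ≤ 1 := by nlinarith [sq_nonneg (ρ - 1 / 2)]
  exact le_of_pow_four_le hF zero_le_one (by rw [one_pow]; linarith)

/-! ### The darkness bound -/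

/-- **Weak-coupling darkness bound.** For `L ≥ 3`, `u > 0`, `0 ≤ U ≤ u⁶`, every `n` and EVERY
normalised ground state `ψ` of the pure repulsive torus `hubbardTorus 2 L 1 U` in the sector
`(2n, S^z = 0)`: `re⟨ψ, (pairField d L)ᴴ (pairField d L) ψ⟩ ≤ 256 u² L⁴ + 288 L²`. [folklore] -/
theorem pairIntensity_groundState_le {L : ℕ} [NeZero L] (hL : 3 ≤ L) {U u : ℝ} (hu : 0 < u)
    (hU : 0 ≤ U) (hUu : U ≤ u ^ 6) {n : ℕ} {ψ : Fock (Orb (FermionTorus 2 L))}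
    (hψ1 : star ψ ⬝ᵥ ψ = 1) (hgs : IsGroundStateInSector (hubbardTorus 2 L 1 U) (2 * n) 0 ψ) :
    (expect ((pairField dWaveFormFactor L)ᴴ * pairField dWaveFormFactor L) ψ).re ≤
      256 * u ^ 2 * (L : ℝ) ^ 4 + 288 * (L : ℝ) ^ 2 := by
  classical
  -- occupations and smearing
  set ρ : TorusSite 2 L → ℝ := fun k => (expect (momentumNumber k 0) ψ).re with hρ
  have hρ0 : ∀ k, 0 ≤ ρ k := fun k => re_expect_momentumNumber_nonneg k 0 ψ
  have hρ1 : ∀ k, ρ k ≤ 1 := fun k => by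
    have := re_expect_momentumNumber_le k 0 ψ
    rwa [hψ1, Complex.one_re] at this
  have hq0 : ∀ k, 0 ≤ ρ k * (1 - ρ k) := fun k => mul_nonneg (hρ0 k) (by linarith [hρ1 k])
  -- (i) smearing budget
  obtain ⟨μ, hsm⟩ := smearing_le_of_groundState L hL U hU n ψ hψ1 hgs
  -- (ii) coherence
  obtain ⟨F, hF0, hF4, hcoh⟩ := pairIntensity_le_coherence L ψ hψ1
  have hF1 : ∀ k, F k ≤ 1 := fun k => le_one_of_pow_four_le_smear (hF0 k) (hF4 k)
  -- (iii) the thin shell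
  set S := Finset.univ.filter fun k : TorusSite 2 L => |torusBand L k - μ| < u ^ 2 with hS
  have hLpos : (0 : ℝ) < L := by exact_mod_cast Nat.pos_of_ne_zero (NeZero.ne L)
  have hScard : (S.card : ℝ) ≤ L * (L * u + 2) := by
    have h := torusShell_count_uniform L μ (u ^ 2)
    have hsq : Real.sqrt (u ^ 2 / 2) ≤ u := by
      rw [Real.sqrt_le_left hu.le]
      nlinarith
    calc (S.card : ℝ) ≤ L * (L * Real.sqrt (u ^ 2 / 2) + 2) := h
      _ ≤ L * (L * u + 2) := by gcongr
  have hSsum : ∑ k ∈ S, F k ≤ u * (L : ℝ) ^ 2 + 2 * L := by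
    calc ∑ k ∈ S, F k ≤ ∑ _k ∈ S, (1 : ℝ) := Finset.sum_le_sum fun k _ => hF1 k
      _ = S.card := by rw [Finset.sum_const, nsmul_eq_mul, mul_one]
      _ ≤ L * (L * u + 2) := hScard
      _ = u * (L : ℝ) ^ 2 + 2 * L := by ring
  -- (iv) off the shell
  set T := Finset.univ.filter fun k : TorusSite 2 L => ¬ |torusBand L k - μ| < u ^ 2 with hT
  have hTcard : (T.card : ℝ) ≤ (L : ℝ) ^ 2 := by
    have : T.card ≤ Fintype.card (TorusSite 2 L) := Finset.card_le_univ T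
    rw [card_torusSite_two] at this
    exact_mod_cast this
  have hT4 : ∑ k ∈ T, F k ^ 4 ≤ u ^ 4 * (L : ℝ) ^ 2 := by
    have hu2 : 0 < u ^ 2 := by positivity
    calc ∑ k ∈ T, F k ^ 4 ≤ ∑ k ∈ T, ρ k * (1 - ρ k) := Finset.sum_le_sum fun k _ => hF4 k
      _ ≤ ∑ k ∈ T, |torusBand L k - μ| * (ρ k * (1 - ρ k)) / u ^ 2 := by
          refine Finset.sum_le_sum fun k hk => ?_
          rw [hT, Finset.mem_filter] at hk
          rw [le_div_iff₀ hu2]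
          have hge : u ^ 2 ≤ |torusBand L k - μ| := not_lt.1 hk.2
          nlinarith [hq0 k]
      _ = (∑ k ∈ T, |torusBand L k - μ| * (ρ k * (1 - ρ k))) / u ^ 2 := by
          rw [Finset.sum_div]
      _ ≤ (∑ k : TorusSite 2 L, |torusBand L k - μ| * (ρ k * (1 - ρ k))) / u ^ 2 :=
          div_le_div_of_nonneg_right (Finset.sum_le_sum_of_subset_of_nonneg (Finset.subset_univ T)
            fun k _ _ => mul_nonneg (abs_nonneg _) (hq0 k)) hu2.le
      _ ≤ U * (L : ℝ) ^ 2 / u ^ 2 := by gcongr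
      _ ≤ u ^ 6 * (L : ℝ) ^ 2 / u ^ 2 := by gcongr
      _ = u ^ 4 * (L : ℝ) ^ 2 := by field_simp
  have hTsum : ∑ k ∈ T, F k ≤ u * (L : ℝ) ^ 2 := by
    have hA0 : 0 ≤ ∑ k ∈ T, F k := Finset.sum_nonneg fun k _ => hF0 k
    refine le_of_pow_four_le hA0 (by positivity) ?_
    calc (∑ k ∈ T, F k) ^ 4 ≤ (T.card : ℝ) ^ 3 * ∑ k ∈ T, F k ^ 4 := pow_four_sum_le T F
      _ ≤ ((L : ℝ) ^ 2) ^ 3 * (u ^ 4 * (L : ℝ) ^ 2) := by gcongr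
      _ = (u * (L : ℝ) ^ 2) ^ 4 := by ring
  -- (v) assemble
  have hsplit : ∑ k : TorusSite 2 L, F k = ∑ k ∈ S, F k + ∑ k ∈ T, F k :=
    (Finset.sum_filter_add_sum_filter_not _ _ _).symm
  have hFsum : ∑ k : TorusSite 2 L, F k ≤ 2 * u * (L : ℝ) ^ 2 + 2 * L := by
    rw [hsplit]; linarith
  have hFsum0 : 0 ≤ ∑ k : TorusSite 2 L, F k := Finset.sum_nonneg fun k _ => hF0 k
  have hsq : (∑ k : TorusSite 2 L, F k) ^ 2 ≤ 8 * u ^ 2 * (L : ℝ) ^ 4 + 8 * (L : ℝ) ^ 2 := by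
    calc (∑ k : TorusSite 2 L, F k) ^ 2 ≤ (2 * u * (L : ℝ) ^ 2 + 2 * L) ^ 2 :=
          pow_le_pow_left₀ hFsum0 hFsum 2
      _ ≤ 8 * u ^ 2 * (L : ℝ) ^ 4 + 8 * (L : ℝ) ^ 2 := by
          nlinarith [sq_nonneg (2 * u * (L : ℝ) ^ 2 - 2 * L)]
  linarith

/-- **Weak-coupling darkness bound, `U^{1/3}` form**: for `L ≥ 3`, `U > 0` and every normalised
sector ground state `ψ` of `hubbardTorus 2 L 1 U`:
`re⟨ψ, P_L ψ⟩ ≤ 256 U^{1/3} L⁴ + 288 L²`. [folklore] -/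
theorem pairIntensity_groundState_le_rpow {L : ℕ} [NeZero L] (hL : 3 ≤ L) {U : ℝ} (hU : 0 < U)
    {n : ℕ} {ψ : Fock (Orb (FermionTorus 2 L))}
    (hψ1 : star ψ ⬝ᵥ ψ = 1) (hgs : IsGroundStateInSector (hubbardTorus 2 L 1 U) (2 * n) 0 ψ) :
    (expect ((pairField dWaveFormFactor L)ᴴ * pairField dWaveFormFactor L) ψ).re ≤
      256 * U ^ (1 / 3 : ℝ) * (L : ℝ) ^ 4 + 288 * (L : ℝ) ^ 2 := by
  have hu : 0 < U ^ (1 / 6 : ℝ) := Real.rpow_pos_of_pos hU _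
  have h6 : (U ^ (1 / 6 : ℝ)) ^ 6 = U := by
    rw [← Real.rpow_natCast, ← Real.rpow_mul hU.le]; norm_num
  have h2 : (U ^ (1 / 6 : ℝ)) ^ 2 = U ^ (1 / 3 : ℝ) := by
    rw [← Real.rpow_natCast, ← Real.rpow_mul hU.le]; norm_num
  have h := pairIntensity_groundState_le hL hu hU.le h6.ge hψ1 hgs
  rwa [h2] at h

/-! ### Consequences for the order constants of the summit window -/

/-- **No order constant above `256u²` survives at a large side.** If `256u² < c`, `0 ≤ U ≤ u⁶`,
`L ≥ 3` with `288 ≤ (c - 256u²) L`, then NO normalised sector ground state of `hubbardTorus 2 L 1 U`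
has `c L⁴ ≤ re⟨ψ, P_L ψ⟩`. [folklore] -/
theorem not_order_of_large_side {L : ℕ} [NeZero L] (hL3 : 3 ≤ L) {U u c : ℝ} (hu : 0 < u)
    (hU : 0 ≤ U) (hUu : U ≤ u ^ 6) (hc : 256 * u ^ 2 < c) (hLbig : 288 ≤ (c - 256 * u ^ 2) * L)
    {n : ℕ} {ψ : Fock (Orb (FermionTorus 2 L))} (hψ1 : star ψ ⬝ᵥ ψ = 1)
    (hgs : IsGroundStateInSector (hubbardTorus 2 L 1 U) (2 * n) 0 ψ)
    (hlow : c * (L : ℝ) ^ 4 ≤ (expect ((pairField dWaveFormFactor L)ᴴ * pairField dWaveFormFactor L) ψ).re) :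
    False := by
  have hup := pairIntensity_groundState_le hL3 hu hU hUu hψ1 hgs
  set d : ℝ := c - 256 * u ^ 2 with hd
  have hdpos : 0 < d := by rw [hd]; linarith
  have hL1 : (1 : ℝ) < L := by exact_mod_cast (show 1 < L by omega)
  have key : d * (L : ℝ) ^ 4 ≤ 288 * (L : ℝ) ^ 2 := by rw [hd]; linarith
  have : d * (L : ℝ) ^ 4 < d * (L : ℝ) ^ 4 := by
    calc d * (L : ℝ) ^ 4 ≤ 288 * (L : ℝ) ^ 2 := key
      _ ≤ (d * L) * (L : ℝ) ^ 2 := by gcongr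
      _ = d * (L : ℝ) ^ 3 := by ring
      _ < d * (L : ℝ) ^ 4 :=
          mul_lt_mul_of_pos_left (pow_lt_pow_right₀ hL1 (by norm_num)) hdpos
  exact lt_irrefl _ this

/-- A large even side beyond a threshold: `L = 2(L₀ + ⌈288/d⌉ + 2)` has `L₀ ≤ L`, `3 ≤ L`, `Even L`
and `288 ≤ d L` (`d > 0`). [folklore] -/
theorem exists_large_even_side (L₀ : ℕ) {d : ℝ} (hd : 0 < d) :
    ∃ L : ℕ, L₀ ≤ L ∧ 3 ≤ L ∧ Even L ∧ 288 ≤ d * L := by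
  refine ⟨2 * (L₀ + ⌈288 / d⌉₊ + 2), by omega, by omega, ⟨L₀ + ⌈288 / d⌉₊ + 2, by ring⟩, ?_⟩
  have h1 : (288 / d : ℝ) ≤ ⌈288 / d⌉₊ := Nat.le_ceil _
  have h2 : ((⌈288 / d⌉₊ : ℕ) : ℝ) ≤ ((2 * (L₀ + ⌈288 / d⌉₊ + 2) : ℕ) : ℝ) := by
    push_cast; linarith [Nat.cast_nonneg (α := ℝ) L₀, Nat.cast_nonneg (α := ℝ) ⌈288 / d⌉₊]
  have h3 : 288 / d ≤ ((2 * (L₀ + ⌈288 / d⌉₊ + 2) : ℕ) : ℝ) := h1.trans h2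
  rwa [div_le_iff₀ hd, mul_comm] at h3

/-- The summit's sector `(2⌊(1-δ)L²/2⌋, 0)` is admissible (`⌊(1-δ)L²/2⌋ ≤ L²`) for `δ ≥ -1`. [folklore] -/
theorem floor_pairNumber_le_card {δ : ℝ} (hδ : -1 ≤ δ) (L : ℕ) :
    ⌊(1 - δ) * (L : ℝ) ^ 2 / 2⌋₊ ≤ Fintype.card (FermionTorus 2 L) := by
  rw [Summit.HubbardSuperconductivity.NoGo.card_fermionTorus_two]
  refine Nat.floor_le_of_le ?_
  have : (1 - δ) * (L : ℝ) ^ 2 / 2 ≤ (L : ℝ) ^ 2 := by nlinarith [sq_nonneg (L : ℝ)]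
  exact_mod_cast this

/-- **Order constants are `O(U^{1/3})`.** If at coupling `0 < U ≤ u⁶` and doping `δ ≥ -1` the pure
torus has an eventual every-GS d-wave order constant `c` (along even sides), then `c ≤ 256 u²`. [folklore] -/
theorem orderConstant_le {U u δ c : ℝ} (hu : 0 < u) (hU : 0 < U) (hUu : U ≤ u ^ 6) (hδ : -1 ≤ δ)
    (h : ∃ L₀ : ℕ, ∀ (L : ℕ) [NeZero L], L₀ ≤ L → Even L →
      ∀ ψ : Fock (Orb (FermionTorus 2 L)), star ψ ⬝ᵥ ψ = 1 →
        IsGroundStateInSector (hubbardTorus 2 L 1 U) (2 * ⌊(1 - δ) * (L : ℝ) ^ 2 / 2⌋₊) 0 ψ →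
          c * (L : ℝ) ^ 4 ≤ (expect ((pairField dWaveFormFactor L)ᴴ * pairField dWaveFormFactor L) ψ).re) :
    c ≤ 256 * u ^ 2 := by
  refine le_of_not_gt fun hlt => ?_
  obtain ⟨L₀, hL₀⟩ := h
  obtain ⟨L, hLge, hL3, hLeven, hLbig⟩ := exists_large_even_side L₀ (d := c - 256 * u ^ 2) (by linarith)
  haveI : NeZero L := ⟨by omega⟩
  obtain ⟨ψ, hψ1, hgs⟩ := exists_unit_groundState U 0 L (floor_pairNumber_le_card hδ L)
  rw [seededH_zero] at hgs
  exact not_order_of_large_side hL3 hu hU.le hUu hlt hLbig hψ1 hgs (hL₀ L hLge hLeven ψ hψ1 hgs)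

/-- **Even ∃-ground-state order constants are `O(U^{1/3})`**: if at coupling `0 < U ≤ u⁶`, eventually
in even `L`, SOME normalised sector ground state has `c L⁴ ≤ re⟨ψ, P_L ψ⟩`, then `c ≤ 256 u²`
(the darkness bound holds for every ground state, in particular for that one). [folklore] -/
theorem existsGSOrderConstant_le {U u δ c : ℝ} (hu : 0 < u) (hU : 0 ≤ U) (hUu : U ≤ u ^ 6)
    (h : ∃ L₀ : ℕ, ∀ (L : ℕ) [NeZero L], L₀ ≤ L → Even L →
      ∃ ψ : Fock (Orb (FermionTorus 2 L)), star ψ ⬝ᵥ ψ = 1 ∧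
        IsGroundStateInSector (hubbardTorus 2 L 1 U) (2 * ⌊(1 - δ) * (L : ℝ) ^ 2 / 2⌋₊) 0 ψ ∧
          c * (L : ℝ) ^ 4 ≤ (expect ((pairField dWaveFormFactor L)ᴴ * pairField dWaveFormFactor L) ψ).re) :
    c ≤ 256 * u ^ 2 := by
  refine le_of_not_gt fun hlt => ?_
  obtain ⟨L₀, hL₀⟩ := h
  obtain ⟨L, hLge, hL3, hLeven, hLbig⟩ := exists_large_even_side L₀ (d := c - 256 * u ^ 2) (by linarith)
  haveI : NeZero L := ⟨by omega⟩
  obtain ⟨ψ, hψ1, hgs, hlow⟩ := hL₀ L hLge hLeven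
  exact not_order_of_large_side hL3 hu hU hUu hlt hLbig hψ1 hgs hlow

/-- **The `U`-uniform every-ground-state order window is FALSE.** At every doping `δ ≥ -1` there
are no `c, U₁ > 0` such that for ALL `U ∈ (0, U₁]`, eventually in even `L`, every normalised
sector ground state of the pure torus `hubbardTorus 2 L 1 U` has `c L⁴ ≤ re⟨ψ, P_L ψ⟩`
(take `U = min(U₁, u⁶)` with `256u² < c`). This refutes the `U`-uniform strengthening of the
summit window that `TwTipContinuation` is equivalent to. [folklore] -/
theorem not_uniformOrderWindow {δ : ℝ} (hδ : -1 ≤ δ) :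
    ¬ ∃ c : ℝ, 0 < c ∧ ∃ U₁ : ℝ, 0 < U₁ ∧ ∀ U ∈ Set.Ioc (0 : ℝ) U₁,
      ∃ L₀ : ℕ, ∀ (L : ℕ) [NeZero L], L₀ ≤ L → Even L →
        ∀ ψ : Fock (Orb (FermionTorus 2 L)), star ψ ⬝ᵥ ψ = 1 →
          IsGroundStateInSector (hubbardTorus 2 L 1 U) (2 * ⌊(1 - δ) * (L : ℝ) ^ 2 / 2⌋₊) 0 ψ →
            c * (L : ℝ) ^ 4 ≤ (expect ((pairField dWaveFormFactor L)ᴴ * pairField dWaveFormFactor L) ψ).re := by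
  rintro ⟨c, hc, U₁, hU₁, h⟩
  -- `u` with `256 u² = c/4 < c`
  set u : ℝ := Real.sqrt (c / 1024) with hu
  have hupos : 0 < u := Real.sqrt_pos.2 (by positivity)
  have hu2 : 256 * u ^ 2 = c / 4 := by
    rw [hu, Real.sq_sqrt (by positivity)]; ring
  set U : ℝ := min U₁ (u ^ 6) with hU
  have hUpos : 0 < U := lt_min hU₁ (by positivity)
  have hUmem : U ∈ Set.Ioc (0 : ℝ) U₁ := ⟨hUpos, min_le_left _ _⟩
  have hbound := orderConstant_le hupos hUpos (min_le_right _ _) hδ (h U hUmem)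
  linarith

/-- **`U`-uniform rungs down to seed `0` are FALSE as well.** At every doping `δ ≥ -1` there are no
`c, g₁, U₁ > 0` such that for ALL `U ∈ (0, U₁]`, eventually in even `L`, every normalised sector
ground state of the SEEDED torus `H_L(U,g)` has `c L⁴ ≤ re⟨ψ, P_L ψ⟩` for all seeds `g ∈ (0, g₁]`:
by the closure of sector ground states as `g ↓ 0` (`exists_groundState_order_of_uniformSeeds`)
such rungs leave an ∃-ground-state order `c` at seed `0`, which the darkness bound forbids for
`U < (c/256)³`. So no rung ladder with `U`-uniform constants reaches the pure model. [folklore] -/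
theorem not_uniformRungsWindow {δ : ℝ} (hδ : -1 ≤ δ) :
    ¬ ∃ c : ℝ, 0 < c ∧ ∃ g₁ : ℝ, 0 < g₁ ∧ ∃ U₁ : ℝ, 0 < U₁ ∧ ∀ U ∈ Set.Ioc (0 : ℝ) U₁,
      ∃ L₀ : ℕ, ∀ (L : ℕ) [NeZero L], L₀ ≤ L → Even L → ∀ g ∈ Set.Ioc (0 : ℝ) g₁,
        ∀ ψ : Fock (Orb (FermionTorus 2 L)), star ψ ⬝ᵥ ψ = 1 →
          IsGroundStateInSector (hubbardTorus 2 L 1 U - ((g / (L : ℝ) ^ 2 : ℝ) : ℂ) • ((pairField dWaveFormFactor L)ᴴ * pairField dWaveFormFactor L)) (2 * ⌊(1 - δ) * (L : ℝ) ^ 2 / 2⌋₊) 0 ψ →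
            c * (L : ℝ) ^ 4 ≤ (expect ((pairField dWaveFormFactor L)ᴴ * pairField dWaveFormFactor L) ψ).re := by
  rintro ⟨c, hc, g₁, hg₁, U₁, hU₁, h⟩
  set u : ℝ := Real.sqrt (c / 1024) with hu
  have hupos : 0 < u := Real.sqrt_pos.2 (by positivity)
  have hu2 : 256 * u ^ 2 = c / 4 := by
    rw [hu, Real.sq_sqrt (by positivity)]; ring
  set U : ℝ := min U₁ (u ^ 6) with hU
  have hUpos : 0 < U := lt_min hU₁ (by positivity)
  have hUmem : U ∈ Set.Ioc (0 : ℝ) U₁ := ⟨hUpos, min_le_left _ _⟩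
  obtain ⟨L₀, hL₀⟩ := h U hUmem
  -- an ordered ground state at seed 0, eventually in even L
  have hex : ∃ L₀' : ℕ, ∀ (L : ℕ) [NeZero L], L₀' ≤ L → Even L →
      ∃ ψ : Fock (Orb (FermionTorus 2 L)), star ψ ⬝ᵥ ψ = 1 ∧
        IsGroundStateInSector (hubbardTorus 2 L 1 U) (2 * ⌊(1 - δ) * (L : ℝ) ^ 2 / 2⌋₊) 0 ψ ∧
          c * (L : ℝ) ^ 4 ≤ (expect ((pairField dWaveFormFactor L)ᴴ * pairField dWaveFormFactor L) ψ).re := by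
    refine ⟨L₀, fun L _ hLge hLeven => ?_⟩
    obtain ⟨ψ, hψ1, hgs, hB⟩ := exists_groundState_order_of_uniformSeeds (U := U)
      (floor_pairNumber_le_card hδ L) hg₁
      (fun g hg0 hg1 ψ hψ hgs => hL₀ L hLge hLeven g ⟨hg0, hg1⟩ ψ hψ hgs)
    rw [seededH_zero] at hgs
    exact ⟨ψ, hψ1, hgs, hB⟩
  have hbound := existsGSOrderConstant_le (δ := δ) hupos hUpos.le (min_le_right _ _) hex
  linarith

/-- **The crux's own witness is quantitatively dark.** If `TwTipContinuation` holds, its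
`U`-uniform summit window (`twTipContinuation_iff_everyGSOrder_window`) comes with order
constants `c(U) ≤ 256 U^{1/3}`: whatever proves the Tip must transport the O(1)-seeded anchor's
`U`-independent order constant (`seededOrder_of_weakCoupling`) down to an `O(U^{1/3})` one at
seed `0`. [folklore] -/
theorem twTipContinuation_orderConstants_vanish (hT : TwTipContinuation) :
    ∃ U₁ : ℝ, 0 < U₁ ∧ ∃ δ ∈ Set.Icc (1 / 10 : ℝ) (2 / 5), ∀ U ∈ Set.Ioc (0 : ℝ) U₁,
      ∃ c : ℝ, 0 < c ∧ c ≤ 256 * U ^ (1 / 3 : ℝ) ∧ ∃ L₀ : ℕ, ∀ (L : ℕ) [NeZero L], L₀ ≤ L → Even L →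
        ∀ ψ : Fock (Orb (FermionTorus 2 L)), star ψ ⬝ᵥ ψ = 1 →
          IsGroundStateInSector (hubbardTorus 2 L 1 U) (2 * ⌊(1 - δ) * (L : ℝ) ^ 2 / 2⌋₊) 0 ψ →
            c * (L : ℝ) ^ 4 ≤ (expect ((pairField dWaveFormFactor L)ᴴ * pairField dWaveFormFactor L) ψ).re := by
  obtain ⟨U₁, hU₁, δ, hδ, h⟩ := twTipContinuation_iff_everyGSOrder_window.1 hT
  refine ⟨U₁, hU₁, δ, hδ, fun U hU => ?_⟩
  obtain ⟨c, hc, hL⟩ := h U hU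
  have hδ1 : -1 ≤ δ := by linarith [hδ.1]
  have hu : 0 < U ^ (1 / 6 : ℝ) := Real.rpow_pos_of_pos hU.1 _
  have h6 : (U ^ (1 / 6 : ℝ)) ^ 6 = U := by
    rw [← Real.rpow_natCast, ← Real.rpow_mul hU.1.le]; norm_num
  have h2 : (U ^ (1 / 6 : ℝ)) ^ 2 = U ^ (1 / 3 : ℝ) := by
    rw [← Real.rpow_natCast, ← Real.rpow_mul hU.1.le]; norm_num
  have hcle := orderConstant_le hu hU.1 h6.ge hδ1 hL
  rw [h2] at hcle
  exact ⟨c, hc, hcle, hL⟩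

/-! ### Closed forms (registered sub-goals of stmt-HubbardSuperconductivity-1700) -/

/-- **Weak-coupling darkness bound (closed form).** For `L ≥ 3`, `u > 0`, `0 ≤ U ≤ u⁶`, every `n`
and every normalised ground state `ψ` of `hubbardTorus 2 L 1 U` in the sector `(2n, S^z = 0)`:
`re⟨ψ, (pairField d L)ᴴ (pairField d L) ψ⟩ ≤ 256 u² L⁴ + 288 L²`. [folklore] -/
theorem weakCouplingDarkness :
    ∀ (L : ℕ) [NeZero L], 3 ≤ L → ∀ (U u : ℝ), 0 < u → 0 ≤ U → U ≤ u ^ 6 → ∀ (n : ℕ) (ψ : Fock (Orb (FermionTorus 2 L))), star ψ ⬝ᵥ ψ = 1 → IsGroundStateInSector (hubbardTorus 2 L 1 U) (2 * n) 0 ψ → (expect ((pairField dWaveFormFactor L)ᴴ * pairField dWaveFormFactor L) ψ).re ≤ 256 * u ^ 2 * (L : ℝ) ^ 4 + 288 * (L : ℝ) ^ 2 :=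
  fun _ _ hL _ _ hu hU hUu _ _ hψ1 hgs => pairIntensity_groundState_le hL hu hU hUu hψ1 hgs

/-- **No `U`-uniform every-ground-state d-wave order window at any doping (closed form).** [folklore] -/
theorem not_uniformOrderWindow_all :
    ∀ δ : ℝ, -1 ≤ δ → ¬ ∃ c : ℝ, 0 < c ∧ ∃ U₁ : ℝ, 0 < U₁ ∧ ∀ U ∈ Set.Ioc (0 : ℝ) U₁, ∃ L₀ : ℕ, ∀ (L : ℕ) [NeZero L], L₀ ≤ L → Even L → ∀ ψ : Fock (Orb (FermionTorus 2 L)), star ψ ⬝ᵥ ψ = 1 → IsGroundStateInSector (hubbardTorus 2 L 1 U) (2 * ⌊(1 - δ) * (L : ℝ) ^ 2 / 2⌋₊) 0 ψ → c * (L : ℝ) ^ 4 ≤ (expect ((pairField dWaveFormFactor L)ᴴ * pairField dWaveFormFactor L) ψ).re :=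
  fun _ hδ => not_uniformOrderWindow hδ

end Summit.HubbardSuperconductivity.TwTipContinuation.WeakCouplingDarkness
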